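import Summits.FinalStateConjecture.FinalStateConjecture.Theorems.EIHFluxBalanceInertialRecessionLorentz

/-!
# Route EIHFluxBalance — `InertialRecession` (stmt-FinalStateConjecture-10166): causal comparison in the lab chart

Helper file for the crux `InertialRecession`. Every causal step of the re-charting / exhaustion transfer
(`stub_rechart` of line sublinear-is-free-clean-window-charges; the shared `stub_cesaroRecharting`; the
analysis `InertialRecession_transfer_obstruction.md` attached to the item) runs on three elementary facts
about a metric `G = g_{M,a} ∘ (boost) + dev` in the lab chart, recorded here once:

* **Kerr–Schild cones lie inside the Minkowski cones**: `η(w, w) ≤ g_{M,a}(x)(w, w)` for `M ≥ 0`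
  (`g − η = 2H ℓ ⊗ ℓ`, `H ≥ 0`; Visser arXiv:0706.0622, (33)), and the same for every boosted,
  translated copy (`minkowski_self_le_boostedKerrBilin_self`);
* hence a `G`-causal vector with `‖G − B‖ ≤ ε`, `B` any field with `η ≤ B` on the diagonal, is
  **`ε`-almost `η`-causal**: `η(w, w) ≤ ε‖w‖²` (`minkowski_self_le_of_nonpos`);
* an `ε`-almost `η`-causal vector has **spatial part at most `√((1+ε)/(1−ε))` times its time part**
  (`spatialNorm_sq_le_of_minkowski_self_le`), so along it the rest-frame time `−η(u, ·)` of a unit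
  timelike observer `u` (`(u⁰)² = 1 + ‖u~‖²`) advances at rate `≥ w⁰ (u⁰ − ‖u~‖ s)`
  (`neg_minkowski_apply_ge`): lab time and every rest-frame time are time functions where `ε` is small.
-/

noncomputable section

open Literature.Geometry.Lorentzian

namespace Summit.FinalStateConjecture.FinalStateConjecture.Theorems

/-- **Kerr–Schild light cones lie inside the Minkowski cones**: `η(w,w) ≤ g_{M,a}(x)(w,w)` for
`M ≥ 0`, since `g − η = 2H ℓ ⊗ ℓ` with `H ≥ 0` (Visser arXiv:0706.0622, (32)–(33)). [cite: arXiv07060622, (33)] -/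
theorem minkowski_self_le_kerr_bilin_self {M : ℝ} (hM : 0 ≤ M) (a : ℝ) (x w : E4) :
    Minkowski.bilin w w ≤ Kerr.bilin M a x w w := by
  rw [Kerr.bilin_apply]
  have hH := Kerr.scalarH_nonneg hM a x
  nlinarith [mul_self_nonneg (Kerr.nullCovector a x w)]

/-- The boosted, translated Kerr–Schild cones lie inside the Minkowski cones:
`η(w,w) ≤ (g_{M,a} ∘ Λ⁻¹(· − c))(Λ⁻¹·, Λ⁻¹·)(w,w)` for `M ≥ 0` (Lorentz invariance of `η` plus the
previous lemma; Kerr–Schild 1965). [cite: KerrSchild1965] -/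
theorem minkowski_self_le_boostedKerrBilin_self' {M : ℝ} (hM : 0 ≤ M) (a : ℝ) (Λ : lorentzGroup)
    (c x w : E4) : Minkowski.bilin w w ≤ boostedKerrBilin Λ c M a x w w := by
  rw [boostedKerrBilin_apply]
  have h := minkowski_self_le_kerr_bilin_self hM a (poincareInv Λ c x) ((Λ : E4 ≃L[ℝ] E4).symm w)
  have hinv := (Λ⁻¹ : lorentzGroup).2 w w
  rw [coe_lorentz_inv] at hinv
  rw [hinv] at h
  exact h

/-- **`G`-causal ⇒ `ε`-almost `η`-causal.** If `η(w,w) ≤ B(w,w)`, `G(w,w) ≤ 0` and `‖G − B‖ ≤ ε`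
(operator norm of bilinear forms on `E4`), then `η(w,w) ≤ ε‖w‖²`. [folklore] -/
theorem minkowski_self_le_of_nonpos {B G : E4 →L[ℝ] E4 →L[ℝ] ℝ} {w : E4} {ε : ℝ}
    (hB : Minkowski.bilin w w ≤ B w w) (hG : G w w ≤ 0) (hGB : ‖G - B‖ ≤ ε) :
    Minkowski.bilin w w ≤ ε * ‖w‖ ^ 2 := by
  have h1 : |(G - B) w w| ≤ ‖G - B‖ * ‖w‖ * ‖w‖ := by
    rw [← Real.norm_eq_abs]
    exact (G - B).le_opNorm₂ w w
  have h2 : (G - B) w w = G w w - B w w := by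
    simp only [sub_apply]
  rw [h2] at h1
  have h3 : B w w - G w w ≤ ε * ‖w‖ ^ 2 := by
    have := (abs_sub_comm (G w w) (B w w)).symm ▸ h1
    have h4 : B w w - G w w ≤ |B w w - G w w| := le_abs_self _
    have h5 : ‖G - B‖ * ‖w‖ * ‖w‖ ≤ ε * ‖w‖ ^ 2 := by
      rw [pow_two, ← mul_assoc]
      exact mul_le_mul_of_nonneg_right (mul_le_mul_of_nonneg_right hGB (norm_nonneg w))
        (norm_nonneg w)
    linarith [abs_sub_comm (G w w) (B w w)]
  linarith

/-- **Almost-causal vectors are almost inside the flat cone**: if `η(w,w) ≤ ε‖w‖²` with `ε < 1` then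
`(1 − ε) ‖w~‖² ≤ (1 + ε) (w⁰)²` (`η(w,w) = −(w⁰)² + ‖w~‖²`, `‖w‖² = (w⁰)² + ‖w~‖²`). [folklore] -/
theorem spatialNorm_sq_le_of_minkowski_self_le {w : E4} {ε : ℝ}
    (h : Minkowski.bilin w w ≤ ε * ‖w‖ ^ 2) :
    (1 - ε) * E4.spatialNorm w ^ 2 ≤ (1 + ε) * w 0 ^ 2 := by
  rw [minkowski_bilin_self, norm_sq_eq_sq_add_spatialNorm_sq] at h
  nlinarith

/-- **Rest-frame time advances along almost-causal future vectors.** For an observer vector `u` with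
`(u⁰)² = 1 + ‖u~‖²`, `u⁰ > 0` (e.g. `u = Λe₀`, `lorentz_apply_zero_sq`) and a vector `w` with
`‖w~‖ ≤ s w⁰`: `−η(u, w) ≥ (u⁰ − s‖u~‖) w⁰` (Cauchy–Schwarz in `E3`). With `s = √((1+ε)/(1−ε))` close to `1`
and `‖u~‖/u⁰ = |v| < 1` the factor is positive: the observer's time `−η(u,·)` is a time function for
the perturbed metric wherever `ε` is small (O'Neill 1983, Ch. 5, Lemma 5.26 ff.). [cite: ONeill1983, Ch. 5] -/
theorem neg_minkowski_apply_ge {u w : E4} {s : ℝ} (hws : E4.spatialNorm w ≤ s * w 0) :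
    (u 0 - s * E4.spatialNorm u) * w 0 ≤ -Minkowski.bilin u w := by
  have hη : Minkowski.bilin u w = -(u 0 * w 0) + inner ℝ (E4.spatial u) (E4.spatial w) := by
    rw [Minkowski.bilin_apply, Fin.sum_univ_three]
    simp only [Fin.succ_zero_eq_one, Fin.succ_one_eq_two]
    rw [show (2 : Fin 3).succ = (3 : Fin 4) from rfl]
    rw [EuclideanSpace.inner_eq_star_dotProduct]
    simp [Fin.sum_univ_three, dotProduct]
    ring
  have hcs : |inner ℝ (E4.spatial u) (E4.spatial w)| ≤ E4.spatialNorm u * E4.spatialNorm w :=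
    abs_real_inner_le_norm _ _
  have h1 : inner ℝ (E4.spatial u) (E4.spatial w) ≤ E4.spatialNorm u * (s * w 0) :=
    ((le_abs_self _).trans hcs).trans (mul_le_mul_of_nonneg_left hws (E4.spatialNorm_nonneg u))
  rw [hη]
  nlinarith

/-- Registered one-line form (helper stub `minkowski_self_le_boostedKerrBilin_self` of the crux item) of
`minkowski_self_le_boostedKerrBilin_self'`: boosted Kerr–Schild cones lie inside the Minkowski cones.
[cite: KerrSchild1965] -/
theorem minkowski_self_le_boostedKerrBilin_self : open Literature.Geometry.Lorentzian in ∀ {M : ℝ}, 0 ≤ M → ∀ (a : ℝ) (Λ : lorentzGroup) (c x w : E4), Minkowski.bilin w w ≤ boostedKerrBilin Λ c M a x w w :=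
  minkowski_self_le_boostedKerrBilin_self'

end Summit.FinalStateConjecture.FinalStateConjecture.Theorems

end
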